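import Summits.AtomisticToContinuum.FouriersLaw.Theorems.HonestZwanzigNetworkReductionObservables
import Literature.MathematicalPhysics.KineticTheory.LangevinChainKernel

/-!
# HonestZwanzig / NetworkReduction — bilinearity of the equilibrium correlation pairings

Support file for item `stmt-AtomisticToContinuum-12701` (`NetworkReduction` of route `HonestZwanzig`,
sub-problem `FouriersLaw`). For the canonical objects of the route (`μ = gibbsMeasure N T`,
`P_t = transitionKernel N T T t`, `corr(f,g)(t) = ∫ f·(P_t g) dμ − μ(f)μ(g)`, `lap_s` its Laplace
transform on `(0,∞)`, `cov` the static covariance) and the admissible class `Adm` of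
`FeshbachIdentities`, this file derives from the fixed-`N` package `hFI` (= the second conjunct of
`FeshbachIdentities`: integrability, `L¹` correlations, time reversal, Kolmogorov identities)
the linearity of `f ↦ corr(f,g)(t)` and `f ↦ lap_s(f,g)` on admissible observables
(`corr_add_left`, `lap_add_left`, `lap_sum_left`, `lap_lincomb_left`), homogeneity (no hypothesis
needed), time reversal for `lap_s` (`lap_rev`), the vanishing of pairings with constants
(`corr_const_right/left`, Markov kernels and a probability Gibbs state), and the static reversal
identity `cov(e_x, g) = cov(g∘Θ, e_x)` (`cov_e_rev`, from the two Kolmogorov identities). All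
gadgets are implicit variables with their defining equations as named hypotheses (instantiated by
`rfl` at the point of use).
-/

noncomputable section

open MeasureTheory Finset Real Set Filter ProbabilityTheory
open Literature.MathematicalPhysics.KineticTheory.HeatConduction

namespace Summit.AtomisticToContinuum.FouriersLaw.Theorems.HonestZwanzig.NetworkReduction

section Bilinear

variable {ω₂ lam β γ : ℝ} {N : ℕ} {T : ℝ}
  {Adm : (PhaseSpace N → ℝ) → Prop}
  {corr : (PhaseSpace N → ℝ) → (PhaseSpace N → ℝ) → ℝ → ℝ}
  {lap : ℝ → (PhaseSpace N → ℝ) → (PhaseSpace N → ℝ) → ℝ}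
  {cov : (PhaseSpace N → ℝ) → (PhaseSpace N → ℝ) → ℝ}
  {e : Fin N → PhaseSpace N → ℝ}
  (hAdm : ∀ f, Adm f ↔ (Continuous f ∧ ∃ A : ℝ, ∀ z,
    |f z| ≤ A * Real.exp ((pinnedChain ω₂ lam β γ).hamiltonian N z / (8 * T))))
  (hcorr : ∀ f g t, corr f g t =
    (∫ z, f z * (∫ y, g y ∂((pinnedChain ω₂ lam β γ).transitionKernel N T T t.toNNReal z))
      ∂(pinnedChain ω₂ lam β γ).gibbsMeasure N T) -
    (∫ z, f z ∂(pinnedChain ω₂ lam β γ).gibbsMeasure N T) *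
      (∫ z, g z ∂(pinnedChain ω₂ lam β γ).gibbsMeasure N T))
  (hlap : ∀ s f g, lap s f g = ∫ t in Set.Ioi (0 : ℝ), Real.exp (-(s * t)) * corr f g t)
  (hcov : ∀ f g, cov f g = (∫ z, f z * g z ∂(pinnedChain ω₂ lam β γ).gibbsMeasure N T) -
    (∫ z, f z ∂(pinnedChain ω₂ lam β γ).gibbsMeasure N T) *
      (∫ z, g z ∂(pinnedChain ω₂ lam β γ).gibbsMeasure N T))
  (he : ∀ x z, e x z = z.2 x ^ 2 / 2 + (pinnedChain ω₂ lam β γ).U (z.1 x) +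
    ∑ j : Fin N, ((if j.val = x.val + 1 then (pinnedChain ω₂ lam β γ).V (z.1 j - z.1 x) / 2 else 0) +
      (if x.val = j.val + 1 then (pinnedChain ω₂ lam β γ).V (z.1 x - z.1 j) / 2 else 0)))
  (hFI : ∀ f g : PhaseSpace N → ℝ, Adm f → Adm g →
    Integrable f ((pinnedChain ω₂ lam β γ).gibbsMeasure N T) ∧
    (∀ t : ℝ, 0 ≤ t → Integrable (fun z => f z *
      (∫ y, g y ∂((pinnedChain ω₂ lam β γ).transitionKernel N T T t.toNNReal z)))
      ((pinnedChain ω₂ lam β γ).gibbsMeasure N T)) ∧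
    IntegrableOn (corr f g) (Set.Ioi 0) ∧
    (∀ t : ℝ, 0 ≤ t → corr f g t = corr (fun z => g (z.1, -z.2)) (fun z => f (z.1, -z.2)) t) ∧
    (∀ s : ℝ, 0 < s → ∀ x : Fin N,
      s * lap s (e x) g - cov (e x) g =
        lap s (fun z => (pinnedChain ω₂ lam β γ).generator N T T (e x) (z.1, -z.2)) g ∧
      s * lap s f (e x) - cov f (e x) = lap s f ((pinnedChain ω₂ lam β γ).generator N T T (e x))))
  (hω : 0 < ω₂) (hl : 0 ≤ lam) (hβ : 0 ≤ β) (hγ : 0 ≤ γ) (hT : 0 < T)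

/-! #### Homogeneity and the zero observable (no hypotheses on the chain) -/

include hcorr in
/-- `corr(c·f, g) = c·corr(f, g)`. -/
theorem corr_const_mul_left (c : ℝ) (f g : PhaseSpace N → ℝ) (t : ℝ) :
    corr (fun z => c * f z) g t = c * corr f g t := by
  rw [hcorr, hcorr]
  simp_rw [mul_assoc]
  rw [integral_const_mul, integral_const_mul]
  ring

include hcorr in
/-- `corr(f, c·g) = c·corr(f, g)`. -/
theorem corr_const_mul_right (c : ℝ) (f g : PhaseSpace N → ℝ) (t : ℝ) :
    corr f (fun z => c * g z) t = c * corr f g t := by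
  rw [hcorr, hcorr]
  simp_rw [integral_const_mul]
  have : ∀ z : PhaseSpace N, f z * (c * ∫ y, g y
      ∂((pinnedChain ω₂ lam β γ).transitionKernel N T T t.toNNReal z)) =
      c * (f z * ∫ y, g y ∂((pinnedChain ω₂ lam β γ).transitionKernel N T T t.toNNReal z)) :=
    fun z => by ring
  simp_rw [this]
  rw [integral_const_mul]
  ring

include hcorr in
/-- `corr(0, g) = 0`. -/
theorem corr_zero_left (g : PhaseSpace N → ℝ) (t : ℝ) : corr (fun _ => 0) g t = 0 := by
  rw [hcorr]
  simp

include hlap in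
/-- `lap` only sees `corr` on `(0, ∞)`. -/
theorem lap_congr {s : ℝ} {f g f' g' : PhaseSpace N → ℝ} (h : ∀ t, 0 < t → corr f g t = corr f' g' t) :
    lap s f g = lap s f' g' := by
  rw [hlap, hlap]
  exact setIntegral_congr_fun measurableSet_Ioi fun t ht => by rw [h t ht]

include hcorr hlap in
/-- `lap_s(c·f, g) = c·lap_s(f, g)`. -/
theorem lap_const_mul_left (s c : ℝ) (f g : PhaseSpace N → ℝ) :
    lap s (fun z => c * f z) g = c * lap s f g := by
  rw [hlap, hlap, ← integral_const_mul]
  refine setIntegral_congr_fun measurableSet_Ioi fun t _ => ?_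
  rw [corr_const_mul_left hcorr]
  ring

include hcorr hlap in
/-- `lap_s(f, c·g) = c·lap_s(f, g)`. -/
theorem lap_const_mul_right (s c : ℝ) (f g : PhaseSpace N → ℝ) :
    lap s f (fun z => c * g z) = c * lap s f g := by
  rw [hlap, hlap, ← integral_const_mul]
  refine setIntegral_congr_fun measurableSet_Ioi fun t _ => ?_
  rw [corr_const_mul_right hcorr]
  ring

include hcorr hlap in
/-- `lap_s(0, g) = 0`. -/
theorem lap_zero_left (s : ℝ) (g : PhaseSpace N → ℝ) : lap s (fun _ => 0) g = 0 := by
  rw [hlap]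
  simp [corr_zero_left hcorr]

/-! #### Additivity and time reversal from the `FeshbachIdentities` package -/

include hcorr hFI in
/-- Additivity of `f ↦ corr(f, g)(t)` on admissible observables, `t ≥ 0`. -/
theorem corr_add_left {f₁ f₂ g : PhaseSpace N → ℝ} (h₁ : Adm f₁) (h₂ : Adm f₂) (hg : Adm g)
    {t : ℝ} (ht : 0 ≤ t) :
    corr (fun z => f₁ z + f₂ z) g t = corr f₁ g t + corr f₂ g t := by
  rw [hcorr, hcorr, hcorr]
  simp_rw [add_mul]
  rw [integral_add ((hFI f₁ g h₁ hg).2.1 t ht) ((hFI f₂ g h₂ hg).2.1 t ht),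
    integral_add (hFI f₁ g h₁ hg).1 (hFI f₂ g h₂ hg).1]
  ring

include hFI in
/-- Time reversal (detailed balance) of the equilibrium correlations, `t ≥ 0`. -/
theorem corr_rev {f g : PhaseSpace N → ℝ} (hf : Adm f) (hg : Adm g) {t : ℝ} (ht : 0 ≤ t) :
    corr f g t = corr (fun z => g (z.1, -z.2)) (fun z => f (z.1, -z.2)) t :=
  (hFI f g hf hg).2.2.2.1 t ht

include hlap hFI in
/-- Time reversal for the Laplace transforms. -/
theorem lap_rev {f g : PhaseSpace N → ℝ} (hf : Adm f) (hg : Adm g) (s : ℝ) :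
    lap s f g = lap s (fun z => g (z.1, -z.2)) (fun z => f (z.1, -z.2)) :=
  lap_congr hlap fun _ ht => corr_rev hFI hf hg ht.le

include hFI in
/-- `t ↦ e^{-st} corr(f,g)(t)` is integrable on `(0,∞)` for `s ≥ 0`. -/
theorem integrableOn_exp_mul_corr {f g : PhaseSpace N → ℝ} (hf : Adm f) (hg : Adm g) {s : ℝ}
    (hs : 0 ≤ s) : IntegrableOn (fun t => Real.exp (-(s * t)) * corr f g t) (Set.Ioi 0) := by
  have hI : IntegrableOn (corr f g) (Set.Ioi 0) := (hFI f g hf hg).2.2.1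
  refine Integrable.bdd_mul (c := 1) hI (by fun_prop) ?_
  filter_upwards [ae_restrict_mem measurableSet_Ioi] with t ht
  rw [Real.norm_eq_abs, abs_of_pos (Real.exp_pos _), ← Real.exp_zero]
  refine Real.exp_le_exp.mpr ?_
  have : 0 ≤ s * t := mul_nonneg hs (le_of_lt ht)
  linarith

include hcorr hlap hFI in
/-- Additivity of `f ↦ lap_s(f, g)` on admissible observables, `s ≥ 0`. -/
theorem lap_add_left {f₁ f₂ g : PhaseSpace N → ℝ} (h₁ : Adm f₁) (h₂ : Adm f₂) (hg : Adm g)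
    {s : ℝ} (hs : 0 ≤ s) :
    lap s (fun z => f₁ z + f₂ z) g = lap s f₁ g + lap s f₂ g := by
  rw [hlap, hlap, hlap, ← integral_add (integrableOn_exp_mul_corr hFI h₁ hg hs)
    (integrableOn_exp_mul_corr hFI h₂ hg hs)]
  refine setIntegral_congr_fun measurableSet_Ioi fun t ht => ?_
  rw [corr_add_left hcorr hFI h₁ h₂ hg (le_of_lt ht)]
  ring

include hAdm hcorr hlap hFI hω hl hβ hT in
/-- Weighted finite sums in the first slot of `lap_s`, `s ≥ 0`. -/
theorem lap_sum_left {ι : Type*} (S : Finset ι) (w : ι → ℝ) (fs : ι → PhaseSpace N → ℝ)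
    (hfs : ∀ i ∈ S, Adm (fs i)) {g : PhaseSpace N → ℝ} (hg : Adm g) {s : ℝ} (hs : 0 ≤ s) :
    lap s (fun z => ∑ i ∈ S, w i * fs i z) g = ∑ i ∈ S, w i * lap s (fs i) g := by
  classical
  induction S using Finset.induction_on with
  | empty => simpa using lap_zero_left hcorr hlap s g
  | insert a S ha ih =>
    have hfa : Adm (fun z => w a * fs a z) :=
      adm_const_mul Adm hAdm (w a) (hfs a (Finset.mem_insert_self a S))
    have hfS : Adm (fun z => ∑ i ∈ S, w i * fs i z) :=
      adm_sum Adm hAdm S (fun i z => w i * fs i z) (adm_const Adm hAdm hω hl hβ hT 0)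
        fun i hi => adm_const_mul Adm hAdm (w i) (hfs i (Finset.mem_insert_of_mem hi))
    have hfun : (fun z => ∑ i ∈ insert a S, w i * fs i z) =
        fun z => w a * fs a z + ∑ i ∈ S, w i * fs i z := by
      funext z
      rw [Finset.sum_insert ha]
    rw [hfun, lap_add_left hcorr hlap hFI hfa hfS hg hs, lap_const_mul_left hcorr hlap,
      ih fun i hi => hfs i (Finset.mem_insert_of_mem hi), Finset.sum_insert ha]

include hAdm hcorr hlap hFI hω hl hβ hT in
/-- Unweighted finite sums in the first slot of `lap_s`, `s ≥ 0`. -/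
theorem lap_sum_left' {ι : Type*} (S : Finset ι) (fs : ι → PhaseSpace N → ℝ)
    (hfs : ∀ i ∈ S, Adm (fs i)) {g : PhaseSpace N → ℝ} (hg : Adm g) {s : ℝ} (hs : 0 ≤ s) :
    lap s (fun z => ∑ i ∈ S, fs i z) g = ∑ i ∈ S, lap s (fs i) g := by
  have h := lap_sum_left hAdm hcorr hlap hFI hω hl hβ hT S (fun _ => 1) fs hfs hg hs
  simp only [one_mul] at h
  exact h

include hcorr hω hl hβ hγ hT in
/-- `corr(f, c)(t) = 0`: the transition kernels are Markov and the Gibbs state is a probability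
measure. -/
theorem corr_const_right (f : PhaseSpace N → ℝ) (c t : ℝ) : corr f (fun _ => c) t = 0 := by
  haveI := pinnedChain_isMarkovKernel_transitionKernel hω hl hβ hγ N T T t.toNNReal
  haveI := pinnedChain_isProbabilityMeasure_gibbsMeasure hω hl hβ γ N hT
  rw [hcorr]
  simp only [integral_const, probReal_univ, smul_eq_mul, one_mul]
  rw [integral_mul_const]
  ring

include hAdm hcorr hFI hω hl hβ hγ hT in
/-- `corr(c, g)(t) = 0` for admissible `g` and `t ≥ 0` (time reversal). -/
theorem corr_const_left {g : PhaseSpace N → ℝ} (hg : Adm g) (c : ℝ) {t : ℝ} (ht : 0 ≤ t) :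
    corr (fun _ => c) g t = 0 := by
  rw [corr_rev hFI (adm_const Adm hAdm hω hl hβ hT c) hg ht]
  exact corr_const_right hcorr hω hl hβ hγ hT _ c t

include hAdm hcorr hlap hFI hω hl hβ hγ hT in
/-- `lap_s(c, g) = 0` for admissible `g`. -/
theorem lap_const_left {g : PhaseSpace N → ℝ} (hg : Adm g) (c s : ℝ) : lap s (fun _ => c) g = 0 := by
  rw [hlap]
  have : ∀ t ∈ Set.Ioi (0 : ℝ), Real.exp (-(s * t)) * corr (fun _ => c) g t = 0 := fun t ht => by
    rw [corr_const_left hAdm hcorr hFI hω hl hβ hγ hT hg c (le_of_lt ht), mul_zero]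
  rw [setIntegral_congr_fun measurableSet_Ioi this]
  simp

include hAdm hcorr hlap hFI hω hl hβ hγ hT in
/-- A finite linear combination plus a constant in the first slot of `lap_s`: if
`F = Σ_b w_b f_b + w₀ f₀ + c₀` pointwise then `lap_s(F, g) = Σ_b w_b lap_s(f_b, g) + w₀ lap_s(f₀, g)`. -/
theorem lap_lincomb_left (w : Fin N → ℝ) (w₀ c₀ : ℝ) (fs : Fin N → PhaseSpace N → ℝ)
    (f₀ F : PhaseSpace N → ℝ) (hF : ∀ z, F z = (∑ b, w b * fs b z) + w₀ * f₀ z + c₀)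
    (hfs : ∀ b, Adm (fs b)) (hf₀ : Adm f₀) {g : PhaseSpace N → ℝ} (hg : Adm g) {s : ℝ} (hs : 0 ≤ s) :
    lap s F g = (∑ b, w b * lap s (fs b) g) + w₀ * lap s f₀ g := by
  have hA : Adm (fun z => ∑ b, w b * fs b z) :=
    adm_sum Adm hAdm Finset.univ (fun b z => w b * fs b z) (adm_const Adm hAdm hω hl hβ hT 0)
      fun b _ => adm_const_mul Adm hAdm (w b) (hfs b)
  have hB : Adm (fun z => w₀ * f₀ z) := adm_const_mul Adm hAdm w₀ hf₀
  have hAB : Adm (fun z => (∑ b, w b * fs b z) + w₀ * f₀ z) := adm_add Adm hAdm hA hB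
  have hC : Adm (fun _ : PhaseSpace N => c₀) := adm_const Adm hAdm hω hl hβ hT c₀
  have hFeq : F = fun z => ((∑ b, w b * fs b z) + w₀ * f₀ z) + c₀ := funext hF
  have h1 := lap_add_left hcorr hlap hFI hAB hC hg hs
  have h2 := lap_add_left hcorr hlap hFI hA hB hg hs
  rw [hFeq, h1, h2, lap_const_left hAdm hcorr hlap hFI hω hl hβ hγ hT hg,
    lap_sum_left hAdm hcorr hlap hFI hω hl hβ hT Finset.univ w fs (fun b _ => hfs b) hg hs,
    lap_const_mul_left hcorr hlap, add_zero]

/-! #### Static identities -/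

include hcov in
/-- The covariance is symmetric. -/
theorem cov_comm (f g : PhaseSpace N → ℝ) : cov f g = cov g f := by
  rw [hcov, hcov]
  simp_rw [mul_comm (f _) (g _)]
  ring

include hcov in
/-- `cov(c·f, g) = c·cov(f, g)`. -/
theorem cov_const_mul_left (c : ℝ) (f g : PhaseSpace N → ℝ) :
    cov (fun z => c * f z) g = c * cov f g := by
  rw [hcov, hcov]
  simp_rw [mul_assoc]
  rw [integral_const_mul, integral_const_mul]
  ring

include hAdm hlap hFI he hω hl hβ hT in
/-- **Static reversal identity** `cov(e_x, g) = cov(g∘Θ, e_x)` for admissible `g`, from the two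
Kolmogorov identities at `s = 1` and time reversal (the site energies are even in `p`). -/
theorem cov_e_rev (hLf : ∀ x, Adm ((pinnedChain ω₂ lam β γ).generator N T T (e x)))
    (x : Fin N) {g : PhaseSpace N → ℝ} (hg : Adm g) :
    cov (e x) g = cov (fun z => g (z.1, -z.2)) (e x) := by
  have hex : Adm (e x) := adm_e Adm hAdm e he hω hl hβ hT x
  have hgr : Adm (fun z => g (z.1, -z.2)) := adm_rev Adm hAdm hg
  have hLr : Adm (fun z => (pinnedChain ω₂ lam β γ).generator N T T (e x) (z.1, -z.2)) :=
    adm_rev Adm hAdm (hLf x)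
  -- Kolmogorov at s = 1
  have k1 := ((hFI (e x) g hex hg).2.2.2.2 1 one_pos x).1
  have k2 := ((hFI (fun z => g (z.1, -z.2)) (e x) hgr hex).2.2.2.2 1 one_pos x).2
  -- time reversal of the two Laplace transforms on the left
  have r1 : lap 1 (e x) g = lap 1 (fun z => g (z.1, -z.2)) (e x) := by
    rw [lap_rev hlap hFI hex hg 1]
    congr 1
    funext z
    exact e_neg_momentum _ e he x z
  have r2 : lap 1 (fun z => (pinnedChain ω₂ lam β γ).generator N T T (e x) (z.1, -z.2)) g =
      lap 1 (fun z => g (z.1, -z.2)) ((pinnedChain ω₂ lam β γ).generator N T T (e x)) := by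
    rw [lap_rev hlap hFI hLr hg 1]
    congr 1
    funext z
    simp
  rw [r1, r2] at k1
  linarith

end Bilinear

end Summit.AtomisticToContinuum.FouriersLaw.Theorems.HonestZwanzig.NetworkReduction
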